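import Summits.Ventures.DiscreteObjects.Hadamard.Order167ItoTypeIff668

/-!
# H(668): the Ito-type array carries the order-167 shift, the quaternion translation and a fixed-point-free REVERSING
# translation — converse and KERNEL IFF 'σ₁₆₇ + centralising involution + fixed-point-free inverting coset ⇔ Ito-type H(668)'

Framing: lottery ticket; floor = certified bounds/negative ranges.

Cell pub-namedobj (venture DiscreteObjects), target (H), hadamard gen 22.  Converse of `Order167ItoTypeIff668`.  For ARBITRARY block
sequences `A : V₄ → ℤ/167 → ℤ` the Ito-type array `M_A ((g,s),(h,t)) = θ_W(g,h) · A_{g+h}(ε_g (t − s))` (`ε_g = +1` for `g₂ = 0`,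
`−1` for `g₂ = 1`; `θ_W` the Williamson sign table) carries:
* `itoArray_shift_aut`: the block shift `σ₀ : (g,s) ↦ (g, s+1)` (permutation automorphism, order `167`);
* `itoArray_translate_aut_a`: the translation `τ₀ : (g,s) ↦ (g + (1,0), s)` with signs `(−1)^{g₁}` (commutes with `σ₀`,
  non-trivial involution pair) — as for the Williamson array, since `ε_{g+(1,0)} = ε_g`;
* `itoArray_reversing_aut_b`: the REVERSING translation `ρ₀ : (g,s) ↦ (g + (0,1), −s)` with signs `(−1)^{g₁+g₂}` — a signed
  automorphism because `ε_{g+(0,1)} = −ε_g` absorbs the reversal; it inverts `σ₀` (`ρ₀σ₀ = σ₀^166 ρ₀`), and `ρ₀`, `ρ₀τ₀` move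
  every row (they translate the block label).
* **`hadamard668_ito_iff`**: **(∃ H(668) with a signed automorphism `σ` of order 167, a signed automorphism `τ` commuting with it
  whose pair is a non-trivial involution, and a signed automorphism `ρ` inverting `σ` such that `ρ` and `ρτ` fix no row)
  ⇔ (∃ `A : V₄ → ℤ/167 → ℤ` whose Ito-type array `M_A` is a Hadamard matrix of order 668)** — i.e. an ITO-TYPE Hadamard matrix
  `(A B C D / −B A −D C / −Cᵀ Dᵀ Aᵀ −Bᵀ / −Dᵀ −Cᵀ Bᵀ Aᵀ)` with circulant blocks of order `167` (Ito 1981; Balonin–Đoković 2015 §9 —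
  the Literature file `ItoArray.lean` has this exact array as `itoMatrix`; the identification with it is the next file).
DICTIONARY.  Both sides OPEN (Ito's conjecture — an Ito-type Hadamard matrix of order `4w` for every odd `w`, Horadam 2007 Research
Problem 6 — is open at `w = 167`; the known families need `2w − 1` or `4w − 1` a prime power, and `333 = 9·37`, `667 = 23·29`).
H(668) untouched; no order excluded; HITS 0/4.  The regular dihedral-type action is the `D_{4w}`-cocyclic framework of Ito /
Flannery 1997 / Horadam 2007 Thm 6.18 (replication-adjacent in conclusion; hypothesis, route and kernel proof ours); no `sorry`, no
definitions (all maps are explicit terms), default heartbeats.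
-/

namespace Summit.Ventures.DiscreteObjects.Hadamard

open Finset BigOperators Matrix

open Literature.Combinatorics.Designs.GoethalsSeidel (IsHadamardMatrix)

section ito
variable (A : ZMod 2 × ZMod 2 → ZMod 167 → ℤ)

/-- **the block shift `σ₀ : (g, s) ↦ (g, s+1)` is a permutation automorphism of the Ito-type array, of order 167** -/
theorem itoArray_shift_aut :
    IsSignedAut (Matrix.of fun (a b : (ZMod 2 × ZMod 2) × ZMod 167) =>
        (if a.1 = 0 then (1 : ℤ) else if a.1 = (1, 0) then (if b.1.1 = 1 then 1 else -1)
          else if a.1 = (0, 1) then (if b.1.1 = b.1.2 then -1 else 1) else (if b.1.2 = 1 then 1 else -1)) *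
        A (a.1 + b.1) (if a.1.2 = 0 then b.2 - a.2 else a.2 - b.2))
      (Equiv.prodCongr (Equiv.refl (ZMod 2 × ZMod 2)) (Equiv.addRight (1 : ZMod 167)))
      (Equiv.prodCongr (Equiv.refl (ZMod 2 × ZMod 2)) (Equiv.addRight (1 : ZMod 167))) (fun _ => 1) (fun _ => 1) ∧
    (Equiv.prodCongr (Equiv.refl (ZMod 2 × ZMod 2)) (Equiv.addRight (1 : ZMod 167))) ^ 167 = 1 ∧
    (Equiv.prodCongr (Equiv.refl (ZMod 2 × ZMod 2)) (Equiv.addRight (1 : ZMod 167))) ≠ 1 := by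
  obtain ⟨-, h167, hne⟩ := williamsonArray_shift_aut A
  refine ⟨⟨fun _ => Or.inl rfl, fun _ => Or.inl rfl, fun i j => ?_⟩, h167, hne⟩
  obtain ⟨g, s⟩ := i
  obtain ⟨h, t⟩ := j
  show (if g = 0 then (1 : ℤ) else if g = (1, 0) then (if h.1 = 1 then 1 else -1)
        else if g = (0, 1) then (if h.1 = h.2 then -1 else 1) else (if h.2 = 1 then 1 else -1)) *
      A (g + h) (if g.2 = 0 then (t + 1) - (s + 1) else (s + 1) - (t + 1)) =
    1 * 1 * ((if g = 0 then (1 : ℤ) else if g = (1, 0) then (if h.1 = 1 then 1 else -1)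
        else if g = (0, 1) then (if h.1 = h.2 then -1 else 1) else (if h.2 = 1 then 1 else -1)) *
      A (g + h) (if g.2 = 0 then t - s else s - t))
  rw [show t + 1 - (s + 1) = t - s by ring, show s + 1 - (t + 1) = s - t by ring]
  ring

/-- **the translation `τ₀` by `a = (1,0)` with signs `(−1)^{g₁}` is a signed automorphism of the Ito-type array** commuting with
the shift, with a non-trivial involution pair (`ε_{g+a} = ε_g`) -/
theorem itoArray_translate_aut_a :
    IsSignedAut (Matrix.of fun (a b : (ZMod 2 × ZMod 2) × ZMod 167) =>
        (if a.1 = 0 then (1 : ℤ) else if a.1 = (1, 0) then (if b.1.1 = 1 then 1 else -1)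
          else if a.1 = (0, 1) then (if b.1.1 = b.1.2 then -1 else 1) else (if b.1.2 = 1 then 1 else -1)) *
        A (a.1 + b.1) (if a.1.2 = 0 then b.2 - a.2 else a.2 - b.2))
      (Equiv.prodCongr (Equiv.addRight ((1, 0) : ZMod 2 × ZMod 2)) (Equiv.refl (ZMod 167)))
      (Equiv.prodCongr (Equiv.addRight ((1, 0) : ZMod 2 × ZMod 2)) (Equiv.refl (ZMod 167)))
      (fun x => if x.1.1 = 0 then 1 else -1) (fun y => if y.1.1 = 0 then 1 else -1) ∧
    Commute (Equiv.prodCongr (Equiv.addRight ((1, 0) : ZMod 2 × ZMod 2)) (Equiv.refl (ZMod 167)))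
      (Equiv.prodCongr (Equiv.refl (ZMod 2 × ZMod 2)) (Equiv.addRight (1 : ZMod 167))) ∧
    (Equiv.prodCongr (Equiv.addRight ((1, 0) : ZMod 2 × ZMod 2)) (Equiv.refl (ZMod 167))) ^ 2 = 1 ∧
    (Equiv.prodCongr (Equiv.addRight ((1, 0) : ZMod 2 × ZMod 2)) (Equiv.refl (ZMod 167))) ≠ 1 := by
  obtain ⟨-, hc, h2, hne⟩ := williamsonArray_translate_aut_a A
  refine ⟨⟨fun x => ?_, fun y => ?_, fun i j => ?_⟩, hc, h2, hne⟩
  · by_cases h : x.1.1 = 0 <;> simp [h]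
  · by_cases h : y.1.1 = 0 <;> simp [h]
  · obtain ⟨g, s⟩ := i
    obtain ⟨h, t⟩ := j
    show (if g + (1, 0) = 0 then (1 : ℤ) else if g + (1, 0) = (1, 0) then (if (h + (1, 0)).1 = 1 then 1 else -1)
          else if g + (1, 0) = (0, 1) then (if (h + (1, 0)).1 = (h + (1, 0)).2 then -1 else 1)
          else (if (h + (1, 0)).2 = 1 then 1 else -1)) *
        A ((g + (1, 0)) + (h + (1, 0))) (if (g + (1, 0)).2 = 0 then t - s else s - t) =
      (if g.1 = 0 then (1 : ℤ) else -1) * (if h.1 = 0 then (1 : ℤ) else -1) *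
        ((if g = 0 then (1 : ℤ) else if g = (1, 0) then (if h.1 = 1 then 1 else -1)
          else if g = (0, 1) then (if h.1 = h.2 then -1 else 1) else (if h.2 = 1 then 1 else -1)) *
        A (g + h) (if g.2 = 0 then t - s else s - t))
    have hg2 : (g + (1, 0)).2 = g.2 := by rw [Prod.snd_add]; exact add_zero _
    rw [hg2, thetaW_translate_a g h, v4_translate_add]
    ring

/-- **the reversing translation `ρ₀ : (g, s) ↦ (g + (0,1), −s)` with signs `(−1)^{g₁+g₂}` is a signed automorphism of the
Ito-type array**, inverting the shift, moving every row, and so does `ρ₀τ₀` -/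
theorem itoArray_reversing_aut_b :
    IsSignedAut (Matrix.of fun (a b : (ZMod 2 × ZMod 2) × ZMod 167) =>
        (if a.1 = 0 then (1 : ℤ) else if a.1 = (1, 0) then (if b.1.1 = 1 then 1 else -1)
          else if a.1 = (0, 1) then (if b.1.1 = b.1.2 then -1 else 1) else (if b.1.2 = 1 then 1 else -1)) *
        A (a.1 + b.1) (if a.1.2 = 0 then b.2 - a.2 else a.2 - b.2))
      (Equiv.prodCongr (Equiv.addRight ((0, 1) : ZMod 2 × ZMod 2)) (Equiv.neg (ZMod 167)))
      (Equiv.prodCongr (Equiv.addRight ((0, 1) : ZMod 2 × ZMod 2)) (Equiv.neg (ZMod 167)))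
      (fun x => if x.1.1 = x.1.2 then 1 else -1) (fun y => if y.1.1 = y.1.2 then 1 else -1) ∧
    (Equiv.prodCongr (Equiv.addRight ((0, 1) : ZMod 2 × ZMod 2)) (Equiv.neg (ZMod 167)) :
        Equiv.Perm ((ZMod 2 × ZMod 2) × ZMod 167)) *
        Equiv.prodCongr (Equiv.refl (ZMod 2 × ZMod 2)) (Equiv.addRight (1 : ZMod 167)) =
      (Equiv.prodCongr (Equiv.refl (ZMod 2 × ZMod 2)) (Equiv.addRight (1 : ZMod 167))) ^ 166 *
        Equiv.prodCongr (Equiv.addRight ((0, 1) : ZMod 2 × ZMod 2)) (Equiv.neg (ZMod 167)) ∧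
    (∀ x, (Equiv.prodCongr (Equiv.addRight ((0, 1) : ZMod 2 × ZMod 2)) (Equiv.neg (ZMod 167))) x ≠ x) ∧
    (∀ x, ((Equiv.prodCongr (Equiv.addRight ((0, 1) : ZMod 2 × ZMod 2)) (Equiv.neg (ZMod 167)) :
        Equiv.Perm ((ZMod 2 × ZMod 2) × ZMod 167)) *
        Equiv.prodCongr (Equiv.addRight ((1, 0) : ZMod 2 × ZMod 2)) (Equiv.refl (ZMod 167))) x ≠ x) := by
  set ρ₀ : Equiv.Perm ((ZMod 2 × ZMod 2) × ZMod 167) :=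
    Equiv.prodCongr (Equiv.addRight ((0, 1) : ZMod 2 × ZMod 2)) (Equiv.neg (ZMod 167)) with hρ₀
  have hρapp : ∀ x : (ZMod 2 × ZMod 2) × ZMod 167, ρ₀ x = (x.1 + (0, 1), -x.2) := fun ⟨g, s⟩ => rfl
  have hσ1 : ∀ x : (ZMod 2 × ZMod 2) × ZMod 167,
      (Equiv.prodCongr (Equiv.refl (ZMod 2 × ZMod 2)) (Equiv.addRight (1 : ZMod 167))) x = (x.1, x.2 + 1) :=
    fun ⟨g, s⟩ => rfl
  have hτ1 : ∀ x : (ZMod 2 × ZMod 2) × ZMod 167,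
      (Equiv.prodCongr (Equiv.addRight ((1, 0) : ZMod 2 × ZMod 2)) (Equiv.refl (ZMod 167))) x = (x.1 + (1, 0), x.2) :=
    fun ⟨g, s⟩ => rfl
  have b1 : ∀ g : ZMod 2 × ZMod 2, g + (0, 1) ≠ g := by decide
  have b2 : ∀ g : ZMod 2 × ZMod 2, g + (1, 0) + (0, 1) ≠ g := by decide
  refine ⟨⟨fun x => ?_, fun y => ?_, fun i j => ?_⟩, ?_, fun x => ?_, fun x => ?_⟩
  · by_cases h : x.1.1 = x.1.2 <;> simp [h]
  · by_cases h : y.1.1 = y.1.2 <;> simp [h]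
  · obtain ⟨g, s⟩ := i
    obtain ⟨h, t⟩ := j
    show (if g + (0, 1) = 0 then (1 : ℤ) else if g + (0, 1) = (1, 0) then (if (h + (0, 1)).1 = 1 then 1 else -1)
          else if g + (0, 1) = (0, 1) then (if (h + (0, 1)).1 = (h + (0, 1)).2 then -1 else 1)
          else (if (h + (0, 1)).2 = 1 then 1 else -1)) *
        A ((g + (0, 1)) + (h + (0, 1))) (if (g + (0, 1)).2 = 0 then -t - -s else -s - -t) =
      (if g.1 = g.2 then (1 : ℤ) else -1) * (if h.1 = h.2 then (1 : ℤ) else -1) *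
        ((if g = 0 then (1 : ℤ) else if g = (1, 0) then (if h.1 = 1 then 1 else -1)
          else if g = (0, 1) then (if h.1 = h.2 then -1 else 1) else (if h.2 = 1 then 1 else -1)) *
        A (g + h) (if g.2 = 0 then t - s else s - t))
    have hflip : A ((g + (0, 1)) + (h + (0, 1))) (if (g + (0, 1)).2 = 0 then -t - -s else -s - -t) =
        A (g + h) (if g.2 = 0 then t - s else s - t) := by
      rw [v4_translate_add]
      by_cases hg : g.2 = 0
      · have h1 : (g + (0, 1)).2 ≠ 0 := by rw [Prod.snd_add, hg]; decide
        rw [if_neg h1, if_pos hg, show -s - -t = t - s by ring]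
      · have hg1 : g.2 = 1 := zmod2_eq_one_of_ne_zero _ hg
        have h1 : (g + (0, 1)).2 = 0 := by rw [Prod.snd_add, hg1]; decide
        rw [if_pos h1, if_neg hg, show -t - -s = s - t by ring]
    rw [hflip, thetaW_translate_b g h]
    ring
  · apply Equiv.ext
    intro x
    rw [Equiv.Perm.mul_apply, Equiv.Perm.mul_apply, hσ1, hρapp, hρapp, blockShift_pow_apply]
    refine Prod.ext rfl ?_
    show -(x.2 + 1) = -x.2 + ((166 : ℕ) : ZMod 167)
    rw [zmod167_166]; ring
  · rw [hρapp]
    intro h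
    exact b1 x.1 (congrArg Prod.fst h)
  · rw [Equiv.Perm.mul_apply, hτ1, hρapp]
    intro h
    exact b2 x.1 (congrArg Prod.fst h)

end ito

/-- **(∃ H(668) with σ₁₆₇, a centralising involution and a fixed-point-free inverting coset) ⇔ (∃ an Ito-type Hadamard matrix of
order 668 with circulant blocks of order 167).** -/
theorem hadamard668_ito_iff :
    (∃ (ι : Type) (_ : Fintype ι) (_ : DecidableEq ι) (H : Matrix ι ι ℤ) (π κ π₁ κ₁ π₂ κ₂ : Equiv.Perm ι)
        (d e d₁ e₁ d₂ e₂ : ι → ℤ) (μ : ℕ), Fintype.card ι = 668 ∧ IsHadamardMatrix H ∧ IsSignedAut H π κ d e ∧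
        π ^ 167 = 1 ∧ κ ^ 167 = 1 ∧ (π ≠ 1 ∨ κ ≠ 1) ∧ IsSignedAut H π₁ κ₁ d₁ e₁ ∧ Commute π₁ π ∧ Commute κ₁ κ ∧
        π₁ ^ 2 = 1 ∧ κ₁ ^ 2 = 1 ∧ (π₁ ≠ 1 ∨ κ₁ ≠ 1) ∧ IsSignedAut H π₂ κ₂ d₂ e₂ ∧ π₂ * π = π ^ μ * π₂ ∧
        κ₂ * κ = κ ^ μ * κ₂ ∧ μ % 167 = 166 ∧ (∀ x, π₂ x ≠ x) ∧ (∀ x, (π₂ * π₁) x ≠ x)) ↔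
    ∃ A : ZMod 2 × ZMod 2 → ZMod 167 → ℤ,
      IsHadamardMatrix (Matrix.of fun (a b : (ZMod 2 × ZMod 2) × ZMod 167) =>
        (if a.1 = 0 then (1 : ℤ) else if a.1 = (1, 0) then (if b.1.1 = 1 then 1 else -1)
          else if a.1 = (0, 1) then (if b.1.1 = b.1.2 then -1 else 1) else (if b.1.2 = 1 then 1 else -1)) *
        A (a.1 + b.1) (if a.1.2 = 0 then b.2 - a.2 else a.2 - b.2)) := by
  constructor
  · rintro ⟨ι, _, _, H, π, κ, π₁, κ₁, π₂, κ₂, d, e, d₁, e₁, d₂, e₂, μ, hι, hH, haut, hπ, hκ, hne, h₁, hc₁, hc₁', hi₁, hi₁',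
      hne₁, h₂, hn₂, hn₂', hμ, hfp, hfp'⟩
    exact exists_itoArray_of_inverting_fpf hH hι haut hπ hκ hne h₁ hc₁ hc₁' hi₁ hi₁' hne₁ h₂ hn₂ hn₂' hμ hfp hfp'
  · rintro ⟨A, hW⟩
    obtain ⟨hσ, h167, hσne⟩ := itoArray_shift_aut A
    obtain ⟨ha, hca, ha2, hane⟩ := itoArray_translate_aut_a A
    obtain ⟨hb, hn, hfp, hfp'⟩ := itoArray_reversing_aut_b A
    exact ⟨(ZMod 2 × ZMod 2) × ZMod 167, inferInstance, inferInstance, _, _, _, _, _, _, _, _, _, _, _, _, _, 166,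
      by simp [ZMod.card], hW, hσ, h167, h167, Or.inl hσne, ha, hca, hca, ha2, ha2, Or.inl hane, hb, hn, hn, rfl, hfp, hfp'⟩

end Summit.Ventures.DiscreteObjects.Hadamard
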